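import Mathlib
import HarnessLib
import Summits.FinalStateConjecture.Statement
import Literature.Geometry.Lorentzian.LandauLifshitzPseudotensor
import Literature.Geometry.Lorentzian.KerrConvergenceProofs
import Literature.Geometry.Lorentzian.KerrWaveEnergy
import Literature.Geometry.Lorentzian.KerrSchildCoord
import Summits.FinalStateConjecture.FinalStateConjecture.Theorems.EIHFluxBalanceInertialRecessionLorentz
import Summits.FinalStateConjecture.FinalStateConjecture.Theorems.EIHFluxBalanceInertialRecessionCalculus

/-!
# Route EIHFluxBalance — `InertialRecession`, re-charting: transport of the Kerr–Schild form by a near-identity frame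

Helper file for the crux `stmt-FinalStateConjecture-10166`
(`Summit.FinalStateConjecture.FinalStateConjecture.Theses.EIHFluxBalance.InertialRecession`),
line `sublinear-is-free-clean-window-charges`, stub `stub_rechart` (the transfer P2), part G1.

The own painted summand pulled back by the honest chart is the rest-frame Kerr–Schild form read in
the transported frame `S = 1 + E` (`E` the frame defect): `ψ^*(g_B)_own − g_{M,a} = g_{M,a}[S·,S·] − g_{M,a}`.
This file provides:
* `norm_iteratedFDeriv_bilinear_two_le` — Leibniz bounds of orders `0, 1, 2` for `B (f y) (g y)`;
* `exists_bound_iteratedFDeriv_kerr` — **uniform `C²` bounds of the Kerr–Schild form `g_{M,a}` on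
  `{r ≥ r₀}`** for every spin (decay at infinity, `Kerr.norm_iteratedFDeriv_ksPert_le`, plus
  compactness of `{x⁰ = 0, r₀ ≤ r ≤ R}` and stationarity);
* `norm_iteratedFDeriv_transport_sub_le` — if `‖Dʲ Q‖ ≤ C_Q` and `‖Dʲ E‖ ≤ ε ≤ 1` (`j ≤ 2`) at
  `y` then `‖Dʲ (Q[S·,S·] − Q)(y)‖ ≤ 30 C_Q ε`. [folklore]
-/

noncomputable section

set_option linter.dupNamespace false

open Set Filter Function Metric Topology
open scoped ContDiff
open Literature.Geometry.Lorentzian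

namespace Summit.FinalStateConjecture.FinalStateConjecture.Theorems.SublinearIsFree.Rechart

/-! ### Leibniz bounds of low order -/

/-- **Leibniz bounds of orders `0, 1, 2`** for `y ↦ B (f y) (g y)` with `‖B‖ ≤ 1`, the factors
being `C²` on an open set `s ∋ x`. [folklore] -/
theorem norm_iteratedFDeriv_bilinear_two_le {D E F G : Type*} [NormedAddCommGroup D] [NormedSpace ℝ D]
    [NormedAddCommGroup E] [NormedSpace ℝ E] [NormedAddCommGroup F] [NormedSpace ℝ F]
    [NormedAddCommGroup G] [NormedSpace ℝ G] (B : E →L[ℝ] F →L[ℝ] G) (hB : ‖B‖ ≤ 1) {f : D → E}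
    {g : D → F} {s : Set D} (hs : IsOpen s) {x : D} (hx : x ∈ s) (hf : ContDiffOn ℝ 2 f s)
    (hg : ContDiffOn ℝ 2 g s) {a₀ a₁ a₂ b₀ b₁ b₂ : ℝ}
    (ha₀ : ‖f x‖ ≤ a₀) (ha₁ : ‖iteratedFDeriv ℝ 1 f x‖ ≤ a₁) (ha₂ : ‖iteratedFDeriv ℝ 2 f x‖ ≤ a₂)
    (hb₀ : ‖g x‖ ≤ b₀) (hb₁ : ‖iteratedFDeriv ℝ 1 g x‖ ≤ b₁) (hb₂ : ‖iteratedFDeriv ℝ 2 g x‖ ≤ b₂) :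
    ‖B (f x) (g x)‖ ≤ a₀ * b₀ ∧
      ‖iteratedFDeriv ℝ 1 (fun y ↦ B (f y) (g y)) x‖ ≤ a₀ * b₁ + a₁ * b₀ ∧
      ‖iteratedFDeriv ℝ 2 (fun y ↦ B (f y) (g y)) x‖ ≤ a₀ * b₂ + 2 * a₁ * b₁ + a₂ * b₀ := by
  have h0a : 0 ≤ a₀ := (norm_nonneg _).trans ha₀
  have h0b : 0 ≤ b₀ := (norm_nonneg _).trans hb₀
  have h1a : 0 ≤ a₁ := (norm_nonneg _).trans ha₁
  have h1b : 0 ≤ b₁ := (norm_nonneg _).trans hb₁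
  have hu : UniqueDiffOn ℝ s := hs.uniqueDiffOn
  have hW : ∀ (n : ℕ) (φ : D → E), iteratedFDerivWithin ℝ n φ s x = iteratedFDeriv ℝ n φ x :=
    fun n φ ↦ iteratedFDerivWithin_of_isOpen n hs hx
  have hW' : ∀ (n : ℕ) (φ : D → F), iteratedFDerivWithin ℝ n φ s x = iteratedFDeriv ℝ n φ x :=
    fun n φ ↦ iteratedFDerivWithin_of_isOpen n hs hx
  have hW'' : ∀ (n : ℕ) (φ : D → G), iteratedFDerivWithin ℝ n φ s x = iteratedFDeriv ℝ n φ x :=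
    fun n φ ↦ iteratedFDerivWithin_of_isOpen n hs hx
  refine ⟨?_, ?_, ?_⟩
  · calc ‖B (f x) (g x)‖ ≤ ‖B‖ * ‖f x‖ * ‖g x‖ := B.le_opNorm₂ _ _
      _ ≤ 1 * a₀ * b₀ := by gcongr
      _ = a₀ * b₀ := by ring
  · have h := B.norm_iteratedFDerivWithin_le_of_bilinear_of_le_one hf hg hu hx (n := 1) (by norm_num) hB
    have hsum : ∑ i ∈ Finset.range (1 + 1), ((1 : ℕ).choose i : ℝ) * ‖iteratedFDerivWithin ℝ i f s x‖ *
        ‖iteratedFDerivWithin ℝ (1 - i) g s x‖ = ‖f x‖ * ‖iteratedFDeriv ℝ 1 g x‖ +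
          ‖iteratedFDeriv ℝ 1 f x‖ * ‖g x‖ := by
      simp [Finset.sum_range_succ, hW, hW']
    rw [hsum, hW''] at h
    have e1 : ‖f x‖ * ‖iteratedFDeriv ℝ 1 g x‖ ≤ a₀ * b₁ := mul_le_mul ha₀ hb₁ (norm_nonneg _) h0a
    have e2 : ‖iteratedFDeriv ℝ 1 f x‖ * ‖g x‖ ≤ a₁ * b₀ := mul_le_mul ha₁ hb₀ (norm_nonneg _) h1a
    linarith
  · have h := B.norm_iteratedFDerivWithin_le_of_bilinear_of_le_one hf hg hu hx (n := 2) le_rfl hB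
    have hsum : ∑ i ∈ Finset.range (2 + 1), ((2 : ℕ).choose i : ℝ) * ‖iteratedFDerivWithin ℝ i f s x‖ *
        ‖iteratedFDerivWithin ℝ (2 - i) g s x‖ = ‖f x‖ * ‖iteratedFDeriv ℝ 2 g x‖ +
          2 * ‖iteratedFDeriv ℝ 1 f x‖ * ‖iteratedFDeriv ℝ 1 g x‖ +
          ‖iteratedFDeriv ℝ 2 f x‖ * ‖g x‖ := by
      simp [Finset.sum_range_succ, hW, hW']
    rw [hsum, hW''] at h
    have e1 : ‖f x‖ * ‖iteratedFDeriv ℝ 2 g x‖ ≤ a₀ * b₂ := mul_le_mul ha₀ hb₂ (norm_nonneg _) h0a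
    have e2 : 2 * ‖iteratedFDeriv ℝ 1 f x‖ * ‖iteratedFDeriv ℝ 1 g x‖ ≤ 2 * a₁ * b₁ :=
      mul_le_mul (by linarith) hb₁ (norm_nonneg _) (by positivity)
    have e3 : ‖iteratedFDeriv ℝ 2 f x‖ * ‖g x‖ ≤ a₂ * b₀ :=
      mul_le_mul ha₂ hb₀ (norm_nonneg _) ((norm_nonneg _).trans ha₂)
    linarith

/-- Pre-composition of an operator field with a fixed continuous linear map (on the argument of
the values) does not increase iterated derivatives by more than the operator norm (open-set version).
[folklore] -/
theorem norm_iteratedFDeriv_clm_postcomp_le {D F G : Type*} [NormedAddCommGroup D] [NormedSpace ℝ D]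
    [NormedAddCommGroup F] [NormedSpace ℝ F] [NormedAddCommGroup G] [NormedSpace ℝ G]
    (L : F →L[ℝ] G) {c : ℝ} (hL : ‖L‖ ≤ c) {f : D → F} {s : Set D} (hs : IsOpen s) {x : D} (hx : x ∈ s)
    (hf : ContDiffOn ℝ ∞ f s) (i : ℕ) :
    ‖iteratedFDeriv ℝ i (fun y ↦ L (f y)) x‖ ≤ c * ‖iteratedFDeriv ℝ i f x‖ := by
  rw [← iteratedFDerivWithin_of_isOpen i hs hx, ← iteratedFDerivWithin_of_isOpen i hs hx,
    show (fun y ↦ L (f y)) = L ∘ f from rfl,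
    L.iteratedFDerivWithin_comp_left (hf x hx) hs.uniqueDiffOn hx (i := i) (by exact_mod_cast le_top)]
  exact (L.norm_compContinuousMultilinearMap_le _).trans (mul_le_mul_of_nonneg_right hL (norm_nonneg _))

/-! ### Uniform `C²` bounds of the Kerr–Schild form away from the ring -/

/-- **Uniform bounds for the derivatives of the Kerr–Schild perturbation on `{r ≥ r₀}`**, every
spin: for each order `m` there is `C` with `‖Dᵐ (g_{M,a} − η)(x)‖ ≤ C` whenever `radius a x ≥ r₀ > 0`.
[folklore] -/
theorem exists_bound_iteratedFDeriv_ksPert (M a : ℝ) {r₀ : ℝ} (hr₀ : 0 < r₀) (m : ℕ) :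
    ∃ C : ℝ, ∀ x : E4, r₀ ≤ Kerr.radius a x →
      ‖iteratedFDeriv ℝ m (fun y ↦ Kerr.bilin M a y - Minkowski.bilin) x‖ ≤ C := by
  obtain ⟨C₁, R₁, hR₁, hfar⟩ := Kerr.norm_iteratedFDeriv_ksPert_le M a m
  -- the compact slice `{x⁰ = 0, r₀ ≤ r ≤ R₁}`
  set K : Set E4 := {x | x 0 = 0} ∩ {x | r₀ ≤ Kerr.radius a x} ∩ {x | Kerr.radius a x ≤ R₁} with hK
  have hc0 : Continuous fun x : E4 ↦ x 0 := (EuclideanSpace.proj (0 : Fin 4) : E4 →L[ℝ] ℝ).continuous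
  have hKc : IsCompact K := by
    refine Metric.isCompact_of_isClosed_isBounded ?_ ?_
    · exact ((isClosed_eq hc0 continuous_const).inter (isClosed_le continuous_const
        (Kerr.continuous_radius a))).inter (isClosed_le (Kerr.continuous_radius a) continuous_const)
    · refine (Metric.isBounded_closedBall (x := (0 : E4)) (r := Real.sqrt (R₁ ^ 2 + a ^ 2))).subset
        fun x hx ↦ ?_
      rw [Metric.mem_closedBall, dist_zero_right]
      have h1 := Kerr.spatialNorm_sq_sub_sq_le_radius_sq a x
      have h2 : Kerr.radius a x ^ 2 ≤ R₁ ^ 2 :=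
        pow_le_pow_left₀ (Kerr.radius_nonneg a x) hx.2 2
      have h3 : ‖x‖ ^ 2 = E4.spatialNorm x ^ 2 := by
        rw [norm_sq_eq_sq_add_spatialNorm_sq x, show x 0 = 0 from hx.1.1]; ring
      refine Real.le_sqrt_of_sq_le ?_
      linarith
  -- continuity of `Dᵐ (g − η)` near `K`
  have hcont : ContinuousOn (fun x ↦ ‖iteratedFDeriv ℝ m (fun y ↦ Kerr.bilin M a y - Minkowski.bilin) x‖) K := by
    refine ContinuousOn.norm fun x hx ↦ ?_
    have hr : 0 < Kerr.radius a x := hr₀.trans_le hx.1.2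
    exact ((Kerr.contDiffAt_ksPert (M := M) hr (n := ∞)).continuousAt_iteratedFDeriv
      (by exact_mod_cast le_top)).continuousWithinAt
  obtain ⟨C₂, hC₂⟩ := hKc.bddAbove_image hcont |>.exists_ge 0 |> fun h ↦ hKc.exists_bound_of_continuousOn hcont
  refine ⟨max (|C₁| / R₁) C₂, fun x hx ↦ ?_⟩
  rcases le_or_gt R₁ (Kerr.radius a x) with hfarx | hnear
  · refine (hfar x hfarx).trans (le_max_of_le_left ?_)
    have hrpos : 0 < Kerr.radius a x := hR₁.trans_le hfarx
    calc C₁ / Kerr.radius a x ≤ |C₁| / Kerr.radius a x :=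
          div_le_div_of_nonneg_right (le_abs_self _) hrpos.le
      _ ≤ |C₁| / R₁ := div_le_div_of_nonneg_left (abs_nonneg _) hR₁ hfarx
  · -- move to the slice `x⁰ = 0`
    set x' : E4 := x - (x 0) • E4.basisVector 0 with hx'
    have hsp : E4.spatial x' = E4.spatial x := by
      rw [hx', map_sub, map_smul]
      have : E4.spatial (E4.basisVector 0) = 0 := by ext i; fin_cases i <;> simp
      rw [this, smul_zero, sub_zero]
    have hx'0 : x' 0 = 0 := by simp [hx']
    have hrad : Kerr.radius a x' = Kerr.radius a x := Kerr.radius_eq_of_spatial_eq a hsp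
    have hder := Kerr.iteratedFDeriv_ksPert_eq_of_spatial_eq M a m hsp
    have hmem : x' ∈ K :=
      ⟨⟨hx'0, show r₀ ≤ Kerr.radius a x' by rw [hrad]; exact hx⟩,
        show Kerr.radius a x' ≤ R₁ by rw [hrad]; exact hnear.le⟩
    have h := hC₂ x' hmem
    rw [Real.norm_eq_abs, abs_of_nonneg (norm_nonneg _), hder] at h
    exact h.trans (le_max_right _ _)

-- deep operator-valued multilinear types: the instance path is slow
set_option synthInstance.maxHeartbeats 200000 in
/-- **Uniform `C²` bound of the Kerr–Schild form on `{r ≥ r₀}`**, every spin. [folklore] -/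
theorem exists_bound_iteratedFDeriv_kerr (M a : ℝ) {r₀ : ℝ} (hr₀ : 0 < r₀) :
    ∃ C : ℝ, 0 ≤ C ∧ ∀ x : E4, r₀ ≤ Kerr.radius a x → ∀ j ≤ 2, ‖iteratedFDeriv ℝ j (Kerr.bilin M a) x‖ ≤ C := by
  obtain ⟨C0, h0⟩ := exists_bound_iteratedFDeriv_ksPert M a hr₀ 0
  obtain ⟨C1, h1⟩ := exists_bound_iteratedFDeriv_ksPert M a hr₀ 1
  obtain ⟨C2, h2⟩ := exists_bound_iteratedFDeriv_ksPert M a hr₀ 2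
  refine ⟨‖(Minkowski.bilin : E4 →L[ℝ] E4 →L[ℝ] ℝ)‖ + |C0| + |C1| + |C2|, by positivity, fun x hx j hj ↦ ?_⟩
  have hr : 0 < Kerr.radius a x := hr₀.trans_le hx
  have hsplit : (Kerr.bilin M a) = (fun _ : E4 ↦ (Minkowski.bilin : E4 →L[ℝ] E4 →L[ℝ] ℝ)) +
      fun y ↦ Kerr.bilin M a y - Minkowski.bilin := by
    funext y; exact (add_sub_cancel Minkowski.bilin (Kerr.bilin M a y)).symm
  have hks : ContDiffAt ℝ j (fun y ↦ Kerr.bilin M a y - Minkowski.bilin) x :=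
    (Kerr.contDiffAt_ksPert (M := M) hr).of_le le_top
  rw [hsplit, iteratedFDeriv_add_apply contDiffAt_const hks]
  refine (norm_add_le _ _).trans ?_
  have hη : ∀ k : ℕ, 1 ≤ k →
      iteratedFDeriv ℝ k (fun _ : E4 ↦ (Minkowski.bilin : E4 →L[ℝ] E4 →L[ℝ] ℝ)) x = 0 := fun k hk ↦ by
    rw [iteratedFDeriv_const_of_ne (𝕜 := ℝ) (E := E4) (by omega : k ≠ 0)
      (Minkowski.bilin : E4 →L[ℝ] E4 →L[ℝ] ℝ), Pi.zero_apply]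
  interval_cases j
  · simp only [norm_iteratedFDeriv_zero]
    have := h0 x hx
    rw [norm_iteratedFDeriv_zero] at this
    linarith [le_abs_self C0, abs_nonneg C1, abs_nonneg C2]
  · rw [hη 1 le_rfl, norm_zero]
    linarith [h1 x hx, le_abs_self C1, abs_nonneg C0, abs_nonneg C2, norm_nonneg (Minkowski.bilin : E4 →L[ℝ] E4 →L[ℝ] ℝ)]
  · rw [hη 2 (by norm_num), norm_zero]
    linarith [h2 x hx, le_abs_self C2, abs_nonneg C0, abs_nonneg C1, norm_nonneg (Minkowski.bilin : E4 →L[ℝ] E4 →L[ℝ] ℝ)]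

/-! ### Transport of a form field by a near-identity frame -/

section Transport

variable {Q : E4 → E4 →L[ℝ] E4 →L[ℝ] ℝ} {E : E4 → E4 →L[ℝ] E4} {s : Set E4} (hs : IsOpen s) {y : E4}
  (hy : y ∈ s) (hQ : ContDiffOn ℝ ∞ Q s) (hE : ContDiffOn ℝ ∞ E s) {CQ ε : ℝ} (hε0 : 0 ≤ ε)
  (hQb : ∀ j ≤ 2, ‖iteratedFDeriv ℝ j Q y‖ ≤ CQ) (hEb : ∀ j ≤ 2, ‖iteratedFDeriv ℝ j E y‖ ≤ ε)

include hs hy hE hEb in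
/-- Slot functions: `‖Dᵏ (z ↦ E z v)(y)‖ ≤ ‖v‖ ε` for `k ≤ 2`. [folklore] -/
theorem norm_iteratedFDerivWithin_slot_le (v : E4) : ∀ k ≤ 2,
    ‖iteratedFDerivWithin ℝ k (fun z ↦ E z v) s y‖ ≤ ‖v‖ * ε := fun k hk ↦ by
  refine (norm_iteratedFDerivWithin_clm_apply_const ((hE y hy).of_le (WithTop.coe_le_coe.mpr le_top))
    hs.uniqueDiffOn hy (N := ((2 : ℕ) : WithTop ℕ∞)) (by exact_mod_cast hk) (c := v)).trans ?_
  rw [iteratedFDerivWithin_of_isOpen k hs hy]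
  exact mul_le_mul_of_nonneg_left (hEb k hk) (norm_nonneg _)

include hs hy hQ hE hQb hEb in
/-- First transported slot: `‖Dⁱ (z ↦ Q z (E z v))(y)‖ ≤ 2ⁱ C_Q ‖v‖ ε` (`i ≤ 2`). [folklore] -/
theorem norm_iteratedFDerivWithin_transportSlot_le (v : E4) : ∀ i ≤ 2,
    ‖iteratedFDerivWithin ℝ i (fun z ↦ Q z (E z v)) s y‖ ≤ 2 ^ i * CQ * (‖v‖ * ε) := fun i hi ↦ by
  have hCQ : 0 ≤ CQ := (norm_nonneg _).trans (hQb 0 (by norm_num))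
  have h := norm_iteratedFDerivWithin_clm_apply (𝕜 := ℝ) (f := Q) (g := fun z ↦ E z v) (n := i)
    (N := ((2 : ℕ) : WithTop ℕ∞)) (hQ.of_le (WithTop.coe_le_coe.mpr le_top))
    ((hE.clm_apply contDiffOn_const).of_le (WithTop.coe_le_coe.mpr le_top)) hs.uniqueDiffOn hy
    (by exact_mod_cast hi)
  refine h.trans (sum_choose_mul_mul_le hCQ (fun k hk ↦ ?_) (fun _ ↦ norm_nonneg _)
    (fun k hk ↦ norm_iteratedFDerivWithin_slot_le hs hy hE hEb v k (hk.trans hi)))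
  rw [iteratedFDerivWithin_of_isOpen k hs hy]
  exact hQb k (hk.trans hi)

include hs hy hQ hE hε0 hQb hEb in
-- three scalar Leibniz estimates and their assembly
set_option maxHeartbeats 400000 in
/-- **Transport by a near-identity frame.** Let `Q` (a field of bilinear forms) and `E` (a field of
operators) be smooth on an open set `s ∋ y`, with `‖Dʲ Q(y)‖ ≤ C_Q` and `‖Dʲ E(y)‖ ≤ ε ≤ 1` for
`j ≤ 2`. Then for `S = 1 + E` and `j ≤ 2`: `‖Dʲ (z ↦ Q(z)[S z ·, S z ·] − Q(z))(y)‖ ≤ 30 C_Q ε`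
(read slot-wise on vectors `v, w`: `Q(Ev, w) + Q(v, Ew) + Q(Ev, Ew)`). [folklore] -/
theorem norm_iteratedFDeriv_transport_sub_le (hε1 : ε ≤ 1) :
    ∀ j ≤ 2, ‖iteratedFDeriv ℝ j (fun z ↦ (Q z).bilinearComp (ContinuousLinearMap.id ℝ E4 + E z)
      (ContinuousLinearMap.id ℝ E4 + E z) - Q z) y‖ ≤ 30 * CQ * ε := by
  have hCQ : 0 ≤ CQ := (norm_nonneg _).trans (hQb 0 (by norm_num))
  have hu : UniqueDiffOn ℝ s := hs.uniqueDiffOn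
  have h2 : ((2 : ℕ) : WithTop ℕ∞) ≤ ∞ := WithTop.coe_le_coe.mpr le_top
  have hQ2 : ContDiffOn ℝ 2 Q s := hQ.of_le h2
  have hE2 : ContDiffOn ℝ 2 E s := hE.of_le h2
  -- smoothness of the target field at `y`
  set S : E4 → E4 →L[ℝ] E4 := fun z ↦ ContinuousLinearMap.id ℝ E4 + E z with hS
  have hSs : ContDiffOn ℝ ∞ S s := contDiffOn_const.add hE
  intro j hj
  have hΨ : ContDiffAt ℝ j (fun z ↦ (Q z).bilinearComp (S z) (S z) - Q z) y := by
    have h1 : ContDiffWithinAt ℝ ∞ (fun z ↦ (Q z).bilinearComp (S z) (S z)) s y :=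
      contDiffWithinAt_bilinearComp_self (hQ y hy) (hSs y hy)
    exact ((h1.sub (hQ y hy)).contDiffAt (hs.mem_nhds hy)).of_le (WithTop.coe_le_coe.mpr le_top)
  refine norm_iteratedFDeriv_le_of_forall_apply₂ hΨ (by positivity) fun v w ↦ ?_
  -- the three scalar pieces
  set t₁ : E4 → ℝ := fun z ↦ Q z (E z v) w with ht₁
  set t₂ : E4 → ℝ := fun z ↦ Q z v (E z w) with ht₂
  set t₃ : E4 → ℝ := fun z ↦ Q z (E z v) (E z w) with ht₃
  have hfun : (fun z ↦ ((Q z).bilinearComp (S z) (S z) - Q z) v w) = t₁ + t₂ + t₃ := by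
    funext z
    simp only [hS, ht₁, ht₂, ht₃, Pi.add_apply, sub_apply, ContinuousLinearMap.bilinearComp_apply,
      add_apply, ContinuousLinearMap.id_apply, map_add]
    ring
  -- smoothness of the pieces on `s`
  have hg₁ : ContDiffOn ℝ 2 (fun z ↦ Q z (E z v)) s := hQ2.clm_apply (hE2.clm_apply contDiffOn_const)
  have hg₂ : ContDiffOn ℝ 2 (fun z ↦ Q z v) s := hQ2.clm_apply contDiffOn_const
  have hEw : ContDiffOn ℝ 2 (fun z ↦ E z w) s := hE2.clm_apply contDiffOn_const
  have ht₁s : ContDiffOn ℝ 2 t₁ s := hg₁.clm_apply contDiffOn_const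
  have ht₂s : ContDiffOn ℝ 2 t₂ s := hg₂.clm_apply hEw
  have ht₃s : ContDiffOn ℝ 2 t₃ s := hg₁.clm_apply hEw
  have hjN : (j : WithTop ℕ∞) ≤ 2 := by exact_mod_cast hj
  -- bounds of the pieces
  have hvε : 0 ≤ ‖v‖ * ε := mul_nonneg (norm_nonneg _) hε0
  have b₁ : ‖iteratedFDerivWithin ℝ j t₁ s y‖ ≤ ‖w‖ * (2 ^ j * CQ * (‖v‖ * ε)) :=
    (norm_iteratedFDerivWithin_clm_apply_const (hg₁ y hy) hu hy hjN (c := w)).trans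
      (mul_le_mul_of_nonneg_left (norm_iteratedFDerivWithin_transportSlot_le hs hy hQ hE hQb hEb v j hj)
        (norm_nonneg _))
  have b₂ : ‖iteratedFDerivWithin ℝ j t₂ s y‖ ≤ 2 ^ j * (‖v‖ * CQ) * (‖w‖ * ε) := by
    have h := norm_iteratedFDerivWithin_clm_apply (𝕜 := ℝ) (f := fun z ↦ Q z v) (g := fun z ↦ E z w)
      (n := j) (N := ((2 : ℕ) : WithTop ℕ∞)) hg₂ hEw hu hy hjN
    refine h.trans (sum_choose_mul_mul_le (mul_nonneg (norm_nonneg _) hCQ) (fun k hk ↦ ?_)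
      (fun _ ↦ norm_nonneg _) (fun k hk ↦ norm_iteratedFDerivWithin_slot_le hs hy hE hEb w k (hk.trans hj)))
    refine (norm_iteratedFDerivWithin_clm_apply_const (hQ2 y hy) hu hy (N := ((2 : ℕ) : WithTop ℕ∞))
      (by exact_mod_cast hk.trans hj) (c := v)).trans ?_
    rw [iteratedFDerivWithin_of_isOpen k hs hy]
    exact mul_le_mul_of_nonneg_left (hQb k (hk.trans hj)) (norm_nonneg _)
  have b₃ : ‖iteratedFDerivWithin ℝ j t₃ s y‖ ≤ 2 ^ j * (2 ^ j * CQ * (‖v‖ * ε)) * (‖w‖ * ε) := by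
    have h := norm_iteratedFDerivWithin_clm_apply (𝕜 := ℝ) (f := fun z ↦ Q z (E z v)) (g := fun z ↦ E z w)
      (n := j) (N := ((2 : ℕ) : WithTop ℕ∞)) hg₁ hEw hu hy hjN
    refine h.trans (sum_choose_mul_mul_le (by positivity) (fun k hk ↦ ?_) (fun _ ↦ norm_nonneg _)
      (fun k hk ↦ norm_iteratedFDerivWithin_slot_le hs hy hE hEb w k (hk.trans hj)))
    refine (norm_iteratedFDerivWithin_transportSlot_le hs hy hQ hE hQb hEb v k (hk.trans hj)).trans ?_
    exact mul_le_mul_of_nonneg_right (mul_le_mul_of_nonneg_right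
      (pow_le_pow_right₀ (by norm_num) hk) hCQ) hvε
  -- assemble
  have hsum : iteratedFDeriv ℝ j (t₁ + t₂ + t₃) y =
      iteratedFDeriv ℝ j t₁ y + iteratedFDeriv ℝ j t₂ y + iteratedFDeriv ℝ j t₃ y := by
    have c1 : ContDiffAt ℝ j t₁ y := (ht₁s.of_le hjN).contDiffAt (hs.mem_nhds hy)
    have c2 : ContDiffAt ℝ j t₂ y := (ht₂s.of_le hjN).contDiffAt (hs.mem_nhds hy)
    have c3 : ContDiffAt ℝ j t₃ y := (ht₃s.of_le hjN).contDiffAt (hs.mem_nhds hy)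
    rw [iteratedFDeriv_add_apply (f := t₁ + t₂) (g := t₃) (by exact c1.add c2) c3,
      iteratedFDeriv_add_apply c1 c2]
  rw [hfun, hsum]
  refine (norm_add₃_le).trans ?_
  rw [← iteratedFDerivWithin_of_isOpen j hs hy, ← iteratedFDerivWithin_of_isOpen j hs hy (f := t₂),
    ← iteratedFDerivWithin_of_isOpen j hs hy (f := t₃)]
  have hp : (2 : ℝ) ^ j ≤ 4 := by
    interval_cases j <;> norm_num
  have hvw : 0 ≤ ‖v‖ * ‖w‖ := mul_nonneg (norm_nonneg _) (norm_nonneg _)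
  have hεε : ε * ε ≤ ε := by nlinarith
  -- `b₁ ≤ 4 CQ ε ‖v‖‖w‖`, `b₂ ≤ 4 CQ ε ‖v‖‖w‖`, `b₃ ≤ 16 CQ ε ‖v‖‖w‖`
  have e₁ : ‖w‖ * (2 ^ j * CQ * (‖v‖ * ε)) ≤ 4 * CQ * ε * (‖v‖ * ‖w‖) := by
    have : ‖w‖ * (2 ^ j * CQ * (‖v‖ * ε)) = 2 ^ j * (CQ * ε * (‖v‖ * ‖w‖)) := by ring
    rw [this]
    nlinarith [mul_nonneg (mul_nonneg hCQ hε0) hvw]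
  have e₂ : 2 ^ j * (‖v‖ * CQ) * (‖w‖ * ε) ≤ 4 * CQ * ε * (‖v‖ * ‖w‖) := by
    have : 2 ^ j * (‖v‖ * CQ) * (‖w‖ * ε) = 2 ^ j * (CQ * ε * (‖v‖ * ‖w‖)) := by ring
    rw [this]
    nlinarith [mul_nonneg (mul_nonneg hCQ hε0) hvw]
  have e₃ : 2 ^ j * (2 ^ j * CQ * (‖v‖ * ε)) * (‖w‖ * ε) ≤ 16 * CQ * ε * (‖v‖ * ‖w‖) := by
    have : 2 ^ j * (2 ^ j * CQ * (‖v‖ * ε)) * (‖w‖ * ε) = (2 ^ j * 2 ^ j) * (CQ * (ε * ε) * (‖v‖ * ‖w‖)) := by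
      ring
    rw [this]
    have h44 : (2 : ℝ) ^ j * 2 ^ j ≤ 16 := by nlinarith [pow_nonneg (by norm_num : (0:ℝ) ≤ 2) j]
    have hin : CQ * (ε * ε) * (‖v‖ * ‖w‖) ≤ CQ * ε * (‖v‖ * ‖w‖) :=
      mul_le_mul_of_nonneg_right (mul_le_mul_of_nonneg_left hεε hCQ) hvw
    nlinarith [mul_nonneg (mul_nonneg hCQ (mul_nonneg hε0 hε0)) hvw, mul_nonneg (mul_nonneg hCQ hε0) hvw]
  calc ‖iteratedFDerivWithin ℝ j t₁ s y‖ + ‖iteratedFDerivWithin ℝ j t₂ s y‖ + ‖iteratedFDerivWithin ℝ j t₃ s y‖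
      ≤ 4 * CQ * ε * (‖v‖ * ‖w‖) + 4 * CQ * ε * (‖v‖ * ‖w‖) + 16 * CQ * ε * (‖v‖ * ‖w‖) := by
        linarith [b₁.trans e₁, b₂.trans e₂, b₃.trans e₃]
    _ ≤ 30 * CQ * ε * ‖v‖ * ‖w‖ := by nlinarith [mul_nonneg (mul_nonneg hCQ hε0) hvw]

end Transport

/-- Registered one-line form (worker carrier `rechart_exists_bound_iteratedFDeriv_kerr`). [folklore] -/
theorem rechart_exists_bound_iteratedFDeriv_kerr : open Literature.Geometry.Lorentzian in ∀ (M a : ℝ) {r₀ : ℝ}, 0 < r₀ → ∃ C : ℝ, 0 ≤ C ∧ ∀ x : E4, r₀ ≤ Kerr.radius a x → ∀ j ≤ 2, ‖iteratedFDeriv ℝ j (Kerr.bilin M a) x‖ ≤ C := fun M a _ hr₀ ↦ exists_bound_iteratedFDeriv_kerr M a hr₀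

end Summit.FinalStateConjecture.FinalStateConjecture.Theorems.SublinearIsFree.Rechart

end
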